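import Summits.AtomisticToContinuum.Crystallization.Theorems.FreeSplittingCertificatesStrictSplittingRuleP1FluxFormQuad

/-!
# `StrictSplittingRule` (stmt-AtomisticToContinuum-12560): flux identification, matrix form — the cell flux form as an explicit `12 × 12` coefficient matrix, and the entrywise-enclosure (Gershgorin) bound the certificate uses (P1 interpolant object, part 43)

Route `FreeSplittingCertificates`, crux r3 `StrictSplittingRule` (H12⋆ = `stub_coreJointCoercive`), unit b2b-freesplit-B gen 29.
VALUE = the last two kernel pieces between the far theorem's boundary term and the "v9" near certificate (HOME CERT §30):
* **`p1FluxQuad_eq_matrix`** — the pure vertex-value form of part 42 is `Σ_{p,q} W_p · p1FluxMat(T) p q · W_q` over `p, q ∈ Fin 4 × Fin 3` with the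
  EXPLICIT coefficient matrix `p1FluxMat` (a-channel on the diagonal blocks `k = l`, bc-channel `B_T`, n-channel `∂λ ⊗ C_T` antisymmetrised in the
  two slots) — up to the frame change `(x, y/√3, z)` and symmetrisation this is the matrix the interval engine `fluxform.py` encloses cell by cell;
* **`abs_quadForm_le_of_abs_le`** — the entrywise-enclosure bound behind the certificate's penalty `Δ`: if `|E p q| ≤ R p q` with `R` symmetric then
  `|Σ_{p,q} x_p E_{pq} x_q| ≤ Σ_p (Σ_q R_{pq}) x_p²`; hence (`quadForm_le_of_enclosure`) an enclosure `|M − M₀| ≤ R` gives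
  `Σ x M x ≤ Σ x M₀ x + Σ_p (Σ_q R_{pq}) x_p²` — the form in which the near ledger books `−κ(F₀ + Δ) ≤ −κ·Q`.
NOT a proof of H12⋆, NOT summit progress.  [folklore]
-/

noncomputable section

open Set Function Finset
open scoped BigOperators

namespace Summit.AtomisticToContinuum.Crystallization.Theorems.StrictSplittingRuleBirth

/-! ## The explicit coefficient matrix of the cell flux form -/

/-- **The `12 × 12` coefficient matrix of the cell flux form** (index `p = (m, k)`: vertex `m`, Cartesian component `k`):
`M p q = [k = l]·a·A_T(m₁,m₂) + (b+c)·B_T(m₁,m₂,k,l) + n·(∂_kλ_{m₂}·C_T(m₁,l) − ∂_kλ_{m₁}·C_T(m₂,l))` for `p = (m₁,k)`, `q = (m₂,l)`. -/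
def p1FluxMat (S1 S2 ca cb cc cn a h : ℝ) (i : (ℤ × ℤ × ℤ) × Fin 6) (p q : Fin 4 × Fin 3) : ℝ :=
  (if p.2 = q.2 then ca * p1FluxA S1 S2 a h i p.1 q.1 else 0) +
    (cb + cc) * p1FluxB S1 S2 a h i p.1 q.1 p.2 q.2 +
      cn * (p1LamGrad a h i q.1 p.2 * p1FluxC S1 S2 a h i p.1 q.2 - p1LamGrad a h i p.1 p.2 * p1FluxC S1 S2 a h i q.1 q.2)

/-- **The cell flux form is the quadratic form of `p1FluxMat`** in the twelve vertex values. -/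
theorem p1FluxQuad_eq_matrix (S1 S2 ca cb cc cn a h : ℝ) (i : (ℤ × ℤ × ℤ) × Fin 6) (W : Fin 4 → Fin 3 → ℝ) :
    p1FluxQuad S1 S2 ca cb cc cn a h i W =
      ∑ p : Fin 4 × Fin 3, ∑ q : Fin 4 × Fin 3, W p.1 p.2 * p1FluxMat S1 S2 ca cb cc cn a h i p q * W q.1 q.2 := by
  simp only [Fintype.sum_prod_type]
  unfold p1FluxQuad p1FluxCellForm p1FluxMat fpTr
  simp +decide only [Fin.sum_univ_four, Fin.sum_univ_three, Fin.isValue, ite_true, ite_false]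
  ring

/-! ## The entrywise-enclosure (Gershgorin-type) bound -/

/-- **Entrywise bound ⇒ quadratic-form bound**: if `|E p q| ≤ R p q` with `R` symmetric, then
`|Σ_{p,q} x_p E_{pq} x_q| ≤ Σ_p (Σ_q R_{pq})·x_p²` (AM–GM on each entry). -/
theorem abs_quadForm_le_of_abs_le {ι : Type*} [Fintype ι] (E R : ι → ι → ℝ) (hE : ∀ p q, |E p q| ≤ R p q)
    (hR : ∀ p q, R p q = R q p) (x : ι → ℝ) :
    |∑ p, ∑ q, x p * E p q * x q| ≤ ∑ p, (∑ q, R p q) * x p ^ 2 := by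
  have hR0 : ∀ p q, 0 ≤ R p q := fun p q => (abs_nonneg _).trans (hE p q)
  have h1 : |∑ p, ∑ q, x p * E p q * x q| ≤ ∑ p, ∑ q, R p q * ((x p ^ 2 + x q ^ 2) / 2) := by
    refine (abs_sum_le_sum_abs _ _).trans (sum_le_sum fun p _ => (abs_sum_le_sum_abs _ _).trans (sum_le_sum fun q _ => ?_))
    rw [abs_mul, abs_mul]
    have h2 : |x p| * |x q| ≤ (x p ^ 2 + x q ^ 2) / 2 := by
      nlinarith [sq_nonneg (|x p| - |x q|), sq_abs (x p), sq_abs (x q)]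
    calc |x p| * |E p q| * |x q| = |E p q| * (|x p| * |x q|) := by ring
      _ ≤ R p q * ((x p ^ 2 + x q ^ 2) / 2) := mul_le_mul (hE p q) h2 (by positivity) (hR0 p q)
  refine h1.trans (le_of_eq ?_)
  have e1 : ∀ p q, R p q * ((x p ^ 2 + x q ^ 2) / 2) = R p q * x p ^ 2 / 2 + R p q * x q ^ 2 / 2 := fun p q => by ring
  simp_rw [e1, sum_add_distrib]
  have e2 : ∑ p, ∑ q, R p q * x q ^ 2 / 2 = ∑ p, ∑ q, R p q * x p ^ 2 / 2 := by
    rw [sum_comm]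
    exact sum_congr rfl fun p _ => sum_congr rfl fun q _ => by rw [hR q p]
  rw [e2, ← sum_add_distrib]
  refine sum_congr rfl fun p _ => ?_
  rw [← sum_add_distrib, sum_mul]
  exact sum_congr rfl fun q _ => by ring

/-- **Enclosure form used by the certificate**: `|M − M₀| ≤ R` entrywise (`R` symmetric) ⇒ `Σ xMx ≤ Σ xM₀x + Σ_p (Σ_q R_{pq}) x_p²`
— with `M = p1FluxMat(T)` at the actual `(a,h)`, `M₀` the dyadic midpoint and `R` the interval radii, summed over cells this is
`Q(v) ≤ vᵀF₀v + Σ_q Δ_q|v_q|²`, i.e. why booking `−κ(F₀ + Δ)` pays at least `κ·Q`. -/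
theorem quadForm_le_of_enclosure {ι : Type*} [Fintype ι] (M M₀ R : ι → ι → ℝ) (hE : ∀ p q, |M p q - M₀ p q| ≤ R p q)
    (hR : ∀ p q, R p q = R q p) (x : ι → ℝ) :
    ∑ p, ∑ q, x p * M p q * x q ≤ (∑ p, ∑ q, x p * M₀ p q * x q) + ∑ p, (∑ q, R p q) * x p ^ 2 := by
  have h := abs_quadForm_le_of_abs_le (fun p q => M p q - M₀ p q) R hE hR x
  have hd : ∑ p, ∑ q, x p * (M p q - M₀ p q) * x q = (∑ p, ∑ q, x p * M p q * x q) - ∑ p, ∑ q, x p * M₀ p q * x q := by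
    rw [← sum_sub_distrib]
    refine sum_congr rfl fun p _ => ?_
    rw [← sum_sub_distrib]
    exact sum_congr rfl fun q _ => by ring
  rw [hd] at h
  linarith [(abs_le.1 h).2]

end Summit.AtomisticToContinuum.Crystallization.Theorems.StrictSplittingRuleBirth

end
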